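import Summits.Ventures.LatticeQCDFlow.Exactness.IMHStickingFloorAllLags
import HarnessLib

/-!
# The summed sticking floor of the flow sampler: `τ_int ≥ ½ + E_{g²w}[r/(1 − r)] / E[g²w]`

HONEST FRAMING: exact (Metropolis-corrected) sampling algorithms for lattice gauge theory;
figures of merit are autocorrelation/cost numbers at stated couplings and volumes; no
continuum-physics claim.  (SCALAR calibration rung S0-A: not a gauge result.)

Venture `LatticeQCDFlow` (cell pub-lqcd), topic `Exactness`; FANOUT row 2 (`s0-phi4`, FLOW arm).
NEW WORK of the cell: the all-lag sticking floor of `IMHStickingFloorAllLags.lean`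
(`ρ(n+1) ≥ E_{g²w}[r^{n+1}]/E[g²w]`, from the cell's Smith–Tierney theorem) summed over all lags by
monotone convergence.  Nothing is cited as a fact.

## What is proved

* **`imhOp_tauInt_ge_stickingOdds`** (general `(X, μ)`; `w, q > 0` measurable integrable,
  `∫ q = 1`; `g` bounded measurable; `r(x) = ∫ (1 − α(x,z)) q(z) dμ(z)`): if the autocorrelation
  series of `g` along the exact chain is summable, then
  `½ + (∫ g² w · r/(1 − r) dμ)/(∫ g² w dμ) ≤ τ_int`
  — each configuration contributes its `g²`-weight times `r/(1 − r)`, the expected number of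
  consecutive rejections from it (partial sums `Σ_{n<N} r^{n+1} ↑ r/(1 − r)`, `lintegral_iSup`;
  where `r = 1` Lean's `1/0 = 0` makes the integrand vanish, and such configurations of positive
  `g²w`-mass are incompatible with summability anyway);
* **`phi4Flow_tauInt_ge_stickingOdds`** — the same for row 2's lattice sampler `imhOpPhi4 J λ q̃`
  (every `λ > 0`, real `J`, positive model density with `∫ q̃ = 1`, bounded `f`, `g = f − ⟨f⟩`).

Reading for S0-A (no numerics implied): the first-moment floor `½ + r_g/(1 − r_g)` of
`FlowSamplerTauIntFloor.lean` is the Jensen shadow of this one (`x ↦ x/(1−x)` convex); a flow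
that covers 99 % of the target well but leaves 1 % of the `g²`-mass at rejection probability
`0.999` already forces `τ_int ≥ ½ + 0.01·999 ≈ 10.5` for that observable.
NOT CLAIMED: summability for any run (hypothesis; automatic under a weight bound), unbounded
observables, numbers for any trained network.
-/

namespace Summit.Ventures.LatticeQCDFlow.Exactness

open Real MeasureTheory Filter Set Topology
open Summit.Ventures.LatticeQCDFlow.Scoring

variable {X : Type*} [MeasurableSpace X] {μ : Measure X} {w q : X → ℝ}

variable [SFinite μ]

/-- **THE SUMMED STICKING FLOOR.**  `w, q > 0` measurable integrable, `∫ q = 1`; `g` bounded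
measurable; `r(x)` the rejection probability from `x`.  If the autocorrelation series of `g` along
the exact chain is summable, then
`½ + (∫ g² w · r/(1 − r) dμ) / (∫ g² w dμ) ≤ τ_int`
— every configuration contributes its `g²`-weight times the expected number `r/(1 − r)` of
consecutive rejections from it (where `r = 1`, Lean's `1/0 = 0` makes the integrand vanish; such
configurations of positive `g²w`-mass are incompatible with summability anyway). -/
theorem imhOp_tauInt_ge_stickingOdds (hw0 : ∀ t, 0 < w t) (hwm : Measurable w)
    (hwi : Integrable w μ) (hq0 : ∀ t, 0 < q t) (hqm : Measurable q) (hqi : Integrable q μ)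
    (hq1 : ∫ z, q z ∂μ = 1) {g : X → ℝ} (hgm : Measurable g) {B : ℝ} (hgb : ∀ t, |g t| ≤ B)
    (hs : Summable fun n => (∫ x, g x * ((imhOp μ w q)^[n + 1] g) x * w x ∂μ)
      / ∫ x, g x ^ 2 * w x ∂μ) :
    1 / 2 + (∫ x, g x ^ 2 * w x * ((∫ z, (1 - imhAcceptQ w q x z) * q z ∂μ)
        / (1 - ∫ z, (1 - imhAcceptQ w q x z) * q z ∂μ)) ∂μ) / ∫ x, g x ^ 2 * w x ∂μ
      ≤ tauInt (fun n => (∫ x, g x * ((imhOp μ w q)^[n] g) x * w x ∂μ) / ∫ x, g x ^ 2 * w x ∂μ) := by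
  obtain ⟨hr0, hr1, hrm⟩ := rejection_bounds (μ := μ) hw0 hwm hq0 hqm hqi hq1
  set r : X → ℝ := fun x => ∫ z, (1 - imhAcceptQ w q x z) * q z ∂μ with hr
  have hr0' : ∀ x, 0 ≤ r x := hr0
  have hr1' : ∀ x, r x ≤ 1 := hr1
  set A := ∫ x, g x ^ 2 * w x ∂μ with hA
  set τ := tauInt (fun n => (∫ x, g x * ((imhOp μ w q)^[n] g) x * w x ∂μ) / A) with hτ
  have hA0 : 0 ≤ A := integral_nonneg fun x => mul_nonneg (sq_nonneg _) (hw0 x).le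
  -- partial sums: `∫ g² w Σ_{n<N} r^{n+1} ≤ A (τ − ½)`
  have hpart := imhOp_tauInt_ge_stickingSum hw0 hwm hwi hq0 hqm hqi hq1 hgm hgb hs
  -- the partial-sum integrands `f_N`
  set f : ℕ → X → ℝ := fun N x => g x ^ 2 * w x * ∑ n ∈ Finset.range N, r x ^ (n + 1) with hf
  have hg2b : ∀ t, |g t ^ 2| ≤ B ^ 2 := fun t => by
    rw [abs_pow]; exact pow_le_pow_left₀ (abs_nonneg _) (hgb t) 2
  have hterm_int : ∀ n, Integrable (fun x => g x ^ 2 * w x * r x ^ (n + 1)) μ := by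
    intro n
    refine Integrable.mono' (hwi.const_mul (B ^ 2)) (((hgm.pow_const 2).mul hwm).mul
      (hrm.pow_const _)).aestronglyMeasurable (Eventually.of_forall fun x => ?_)
    rw [Real.norm_eq_abs, abs_mul, abs_mul, abs_of_pos (hw0 x), abs_of_nonneg (pow_nonneg (hr0' x) _)]
    calc |g x ^ 2| * w x * r x ^ (n + 1) ≤ B ^ 2 * w x * 1 :=
          mul_le_mul (mul_le_mul_of_nonneg_right (hg2b x) (hw0 x).le) (pow_le_one₀ (hr0' x) (hr1' x))
            (pow_nonneg (hr0' x) _) (mul_nonneg (sq_nonneg _) (hw0 x).le)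
      _ = B ^ 2 * w x := mul_one _
  have hf_int : ∀ N, Integrable (f N) μ := by
    intro N
    have e : f N = fun x => ∑ n ∈ Finset.range N, g x ^ 2 * w x * r x ^ (n + 1) := by
      funext x
      simp only [hf, Finset.mul_sum]
    rw [e]
    exact integrable_finsetSum _ fun n _ => hterm_int n
  have hf_nonneg : ∀ N x, 0 ≤ f N x := fun N x =>
    mul_nonneg (mul_nonneg (sq_nonneg _) (hw0 x).le) (Finset.sum_nonneg fun n _ => pow_nonneg (hr0' x) _)
  have hf_mono : ∀ x, Monotone fun N => f N x := by
    intro x N N' hNN'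
    simp only [hf]
    refine mul_le_mul_of_nonneg_left ?_ (mul_nonneg (sq_nonneg _) (hw0 x).le)
    exact Finset.sum_le_sum_of_subset_of_nonneg (Finset.range_mono hNN') fun n _ _ => pow_nonneg (hr0' x) _
  have hf_meas : ∀ N, Measurable (f N) := fun N =>
    ((hgm.pow_const 2).mul hwm).mul (Finset.measurable_sum _ fun n _ => hrm.pow_const _)
  have hf_le : ∀ N, ∫ x, f N x ∂μ ≤ A * (τ - 1 / 2) := by
    intro N
    have h := hpart N
    have e : ∫ x, f N x ∂μ = ∑ n ∈ Finset.range N, ∫ x, g x ^ 2 * w x * r x ^ (n + 1) ∂μ := by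
      rw [← integral_finsetSum _ fun n _ => hterm_int n]
      refine integral_congr_ae (Eventually.of_forall fun x => ?_)
      simp only [hf, Finset.mul_sum]
    rw [e]
    rcases eq_or_lt_of_le hA0 with hz | hpos
    · -- `A = 0`: every term vanishes (`g = 0` a.e. `w`), via `term ≤ B'·A`-type bound: use `0 ≤ term ≤ ∫ g² w`
      have hle : ∀ n, ∫ x, g x ^ 2 * w x * r x ^ (n + 1) ∂μ ≤ A := fun n => by
        refine integral_mono (hterm_int n) ?_ fun x => ?_
        · exact integrable_mul_mul_weight hw0 hwm hwi (hgm.pow_const 2) measurable_const hg2b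
            (fun _ => (abs_one).le) |>.congr (Eventually.of_forall fun x => by simp)
        · show g x ^ 2 * w x * r x ^ (n + 1) ≤ g x ^ 2 * w x
          exact mul_le_of_le_one_right (mul_nonneg (sq_nonneg _) (hw0 x).le)
            (pow_le_one₀ (hr0' x) (hr1' x))
      have h0 : ∀ n, 0 ≤ ∫ x, g x ^ 2 * w x * r x ^ (n + 1) ∂μ := fun n =>
        integral_nonneg fun x => mul_nonneg (mul_nonneg (sq_nonneg _) (hw0 x).le) (pow_nonneg (hr0' x) _)
      have hsum0 : ∑ n ∈ Finset.range N, ∫ x, g x ^ 2 * w x * r x ^ (n + 1) ∂μ = 0 :=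
        Finset.sum_eq_zero fun n _ => le_antisymm ((hle n).trans hz.symm.le) (h0 n)
      rw [hsum0, ← hz, zero_mul]
    · have h' : ∑ n ∈ Finset.range N, (∫ x, g x ^ 2 * w x * r x ^ (n + 1) ∂μ) / A ≤ τ - 1 / 2 := by
        linarith
      rw [← Finset.sum_div, div_le_iff₀ hpos] at h'
      linarith
  -- the summed integrand is dominated pointwise by `⨆_N f_N` (in `ℝ≥0∞`)
  have hptw : ∀ x, ENNReal.ofReal (g x ^ 2 * w x * (r x / (1 - r x)))
      ≤ ⨆ N, ENNReal.ofReal (f N x) := by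
    intro x
    rcases eq_or_lt_of_le (hr1' x) with h1 | hlt
    · -- `r x = 1`: the integrand is `0`
      rw [h1, sub_self, div_zero, mul_zero, ENNReal.ofReal_zero]
      exact bot_le
    · -- `r x < 1`: `f N x → g² w · r/(1−r)`, a monotone limit is a supremum
      have habs : |r x| < 1 := by rw [abs_of_nonneg (hr0' x)]; exact hlt
      have hlim : Tendsto (fun N => f N x) atTop (𝓝 (g x ^ 2 * w x * (r x / (1 - r x)))) := by
        simp only [hf]
        exact ((hasSum_geometric_succ habs).tendsto_sum_nat).const_mul _
      have hlim' := ENNReal.tendsto_ofReal hlim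
      have hsup : Tendsto (fun N => ENNReal.ofReal (f N x)) atTop (𝓝 (⨆ N, ENNReal.ofReal (f N x))) :=
        tendsto_atTop_iSup fun N N' h => ENNReal.ofReal_le_ofReal (hf_mono x h)
      exact (tendsto_nhds_unique hlim' hsup).le
  -- monotone convergence
  have hL : ∫⁻ x, ENNReal.ofReal (g x ^ 2 * w x * (r x / (1 - r x))) ∂μ
      ≤ ENNReal.ofReal (A * (τ - 1 / 2)) := by
    calc ∫⁻ x, ENNReal.ofReal (g x ^ 2 * w x * (r x / (1 - r x))) ∂μ
        ≤ ∫⁻ x, ⨆ N, ENNReal.ofReal (f N x) ∂μ := lintegral_mono fun x => hptw x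
      _ = ⨆ N, ∫⁻ x, ENNReal.ofReal (f N x) ∂μ :=
          lintegral_iSup (fun N => (hf_meas N).ennreal_ofReal)
            (fun N N' h x => ENNReal.ofReal_le_ofReal (hf_mono x h))
      _ = ⨆ N, ENNReal.ofReal (∫ x, f N x ∂μ) := by
          congr 1
          funext N
          rw [ofReal_integral_eq_lintegral_ofReal (hf_int N) (Eventually.of_forall (hf_nonneg N))]
      _ ≤ ENNReal.ofReal (A * (τ - 1 / 2)) := iSup_le fun N => ENNReal.ofReal_le_ofReal (hf_le N)
  have hI : ∫ x, g x ^ 2 * w x * (r x / (1 - r x)) ∂μ ≤ A * (τ - 1 / 2) := by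
    have hnn : 0 ≤ᵐ[μ] fun x => g x ^ 2 * w x * (r x / (1 - r x)) :=
      Eventually.of_forall fun x => mul_nonneg (mul_nonneg (sq_nonneg _) (hw0 x).le)
        (div_nonneg (hr0' x) (sub_nonneg.2 (hr1' x)))
    rw [integral_eq_lintegral_of_nonneg_ae hnn ((((hgm.pow_const 2).mul hwm).mul
      (hrm.div (measurable_const.sub hrm))).aestronglyMeasurable)]
    have hAτ : 0 ≤ A * (τ - 1 / 2) := by
      have h := hf_le 0
      have e : ∫ x, f 0 x ∂μ = 0 := by simp [hf]
      linarith
    exact ENNReal.toReal_le_of_le_ofReal hAτ hL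
  -- conclude
  rcases eq_or_lt_of_le hA0 with hz | hpos
  · rw [← hz, div_zero, add_zero]
    have h := hpart 0
    simp only [Finset.range_zero, Finset.sum_empty, add_zero] at h
    exact h
  · rw [← sub_nonneg]
    have : (∫ x, g x ^ 2 * w x * (r x / (1 - r x)) ∂μ) / A ≤ τ - 1 / 2 := by
      rw [div_le_iff₀ hpos]
      linarith
    linarith

/-! ## The lattice -/

section Lattice

variable {n : ℕ}

/-- **SUMMED STICKING FLOOR FOR THE φ⁴ FLOW SAMPLER**: with `g = f − ⟨f⟩` and `r(φ)` the
rejection probability of row 2's sampler, a summable autocorrelation series forces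
`τ_int(f) ≥ ½ + (∫ g² e^{−S} r/(1 − r) dφ)/(∫ g² e^{−S} dφ)`. -/
theorem phi4Flow_tauInt_ge_stickingOdds {lam : ℝ} (hlam : 0 < lam)
    (J : Fin (n + 1) → Fin (n + 1) → ℝ) {q : (Fin (n + 1) → ℝ) → ℝ} (hq0 : ∀ φ, 0 < q φ)
    (hqm : Measurable q) (hqi : Integrable q) (hq1 : ∫ φ, q φ = 1)
    {f : (Fin (n + 1) → ℝ) → ℝ} (hfm : Measurable f) {B : ℝ} (hfb : ∀ φ, |f φ| ≤ B)
    (hs : Summable fun k => (∫ φ, (f φ - gibbsExpect J lam f)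
        * ((imhOpPhi4 J lam q)^[k + 1] (fun ψ => f ψ - gibbsExpect J lam f)) φ * gibbsWeight J lam φ)
        / ∫ φ, (f φ - gibbsExpect J lam f) ^ 2 * gibbsWeight J lam φ) :
    1 / 2 + (∫ φ, (f φ - gibbsExpect J lam f) ^ 2 * gibbsWeight J lam φ
        * ((∫ φ', (1 - imhAcceptQ (gibbsWeight J lam) q φ φ') * q φ')
          / (1 - ∫ φ', (1 - imhAcceptQ (gibbsWeight J lam) q φ φ') * q φ')))
        / ∫ φ, (f φ - gibbsExpect J lam f) ^ 2 * gibbsWeight J lam φ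
      ≤ tauInt (fun k => (∫ φ, (f φ - gibbsExpect J lam f)
        * ((imhOpPhi4 J lam q)^[k] (fun ψ => f ψ - gibbsExpect J lam f)) φ * gibbsWeight J lam φ)
        / ∫ φ, (f φ - gibbsExpect J lam f) ^ 2 * gibbsWeight J lam φ) := by
  obtain ⟨hgm, hgb, -⟩ := centred_observable hlam J hfm hfb
  rw [imhOpPhi4_eq_imhOp] at hs ⊢
  exact imhOp_tauInt_ge_stickingOdds (μ := volume) (fun φ => gibbsWeight_pos J lam φ)
    (continuous_gibbsWeight J lam).measurable (integrable_gibbsWeight hlam J) hq0 hqm hqi hq1 hgm hgb hs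

end Lattice

end Summit.Ventures.LatticeQCDFlow.Exactness
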